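import Literature.NumberTheory.Automorphic.UnitaryGroupIsotropicRootDuality
import Literature.NumberTheory.GelbartRogawski1991.LocalUnitaryDiagonalDoubling
import Literature.RepresentationTheory.HeisenbergGroup.DoubledSpaceBlockEndomorphism
import Literature.RepresentationTheory.MoeglinVignerasWaldspurger1987.RankOneThetaLinesDoubledPlaneAnisotropic
import Literature.RepresentationTheory.MoeglinVignerasWaldspurger1987.RankOneThetaLiftLinesSplitPlace
import HarnessLib

/-!
# The doubled root nilpotent of `rankOne_theta_lines_disjoint` (row IV-4(c1), piece P3)

Topic `RepresentationTheory/MoeglinVignerasWaldspurger1987`; theorems only (no definition, no named fact).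

For the two embeddings `ι_{δ₁}, ι_{δ₂} : U(V)(F_v) → Sp(𝕎_v)` (`δ₂ = a δ₁`, `a ∈ Fˣ`) and the diagonal doubling
`𝔻 = j̃(s₁, conj s₂) : U(V)(F_v) →* S̃p_ψ(𝕎_v ⊕ 𝕎⁻_v)` (`LocalUnitaryDiagonalDoubling`), the root subgroup `b ↦ n_{bδ₁}(r)` of an
isotropic vector `r ∈ E_v^N` (`UnitaryGroup.localRootElt`, piece P2) acts on the doubled space `𝕎^⊕ = F_v^{N+N} × F_v^{N+N}`
through the BLOCK-DIAGONAL nilpotent `𝔫^⊕ = 𝔫_{δ₁}(r) ⊕ a⁻¹ 𝔫_{δ₂}(r)` (`proj_diagonalDoubling_localRootElt_apply`: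
`π(𝔻(n_b)) = 1 + b 𝔫^⊕`).  This file proves the properties of `𝔫^⊕` which the polarisation mover (piece P4,
`SiegelUnipotentOfIsotropicImage`) and the quadric engine (piece P7, `QuadricVanishingOfRootFamilies`) consume:

* per block the inputs are B-p10's `UnitaryGroupIsotropicRootSymplectic` / `UnitaryGroupHyperbolicSwap` /
  `UnitaryGroupIsotropicRootDuality` (`alt_polar_localRootNil_left`, `disjoint_range_localRootNil_orthogonal`,
  `finrank_range_localRootNil`, `iota_localRootElt_apply(_of_eq_mul)`, `toLocalRing_alt_polar_localRootNil_self`);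
* doubled (`§1`): `(𝔫^⊕)² = 0`, skewness for `A^⊕ = A_T ⊕ A_{−T}`, duality of `im 𝔫^⊕(r)` and `im 𝔫^⊕(r')`,
  `dim im 𝔫^⊕ = 4`, and the ANISOTROPY `A^⊕(w, 𝔫^⊕ w) = 0 ⇒ 𝔫^⊕ w = 0` — the quadratic form `w ↦ A^⊕(w, 𝔫^⊕ w)` is the
  norm form of the doubled plane `⟨ε₁⟩ ⊕ ⟨−ε₂⟩`, anisotropic exactly under the class hypothesis of
  `rankOne_theta_lines_disjoint` (`LemD1OfPlace.eps_doubledPlane_anisotropic`);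
* packaged (`§2`): `exists_doubledRootNilpotents` — from the binders of `rankOne_theta_lines_disjoint` (`N ≥ 3`, `E_v` a
  field, the class hypothesis, sections `s₁, s₂` over `ι_{δ₁}, ι_{δ₂}`), two one-parameter families `nr, nr'` in `U(V)(F_v)`
  and two nilpotents `𝔫, 𝔫'` of `𝕎^⊕` with all of the above.

HC_CM is proved only modulo the printed citations until rung 0 of the ladder closes; nothing about theta lifts is
asserted here.

## References
* [MoeglinVignerasWaldspurger1987] C. Mœglin, M.-F. Vignéras, J.-L. Waldspurger, LNM 1291 (1987), Chap. 1 I.17 (root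
  subgroups through `Res`), Chap. 2 II.1 Rem. (6) (the doubled space), Chap. 3 IV (rank-one theta dichotomy).
* [Liu2021] Y. Liu, App. D §D.1 Step 1, Lem. D.1 (3) (the class hypothesis).
* [Dieudonne1971GroupesClassiques] J. Dieudonné, *La géométrie des groupes classiques*, Chap. II §5.
-/

set_option autoImplicit false

noncomputable section

open NumberField IsDedekindDomain Matrix
open Literature.NumberTheory.Automorphic Literature.NumberTheory.Automorphic.UnitaryGroup
open Literature.RepresentationTheory.HeisenbergGroup
open Literature.NumberTheory.GelbartRogawski1991.UnitaryDualPair.LocalSplitting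

namespace Literature.RepresentationTheory.MoeglinVignerasWaldspurger1987

/-! ## §1 The doubled nilpotent `𝔫^⊕ = 𝔫_{δ₁}(r) ⊕ a⁻¹ 𝔫_{δ₂}(r)` of `𝕎 ⊕ 𝕎⁻` -/

section Doubled

variable (F : Type) [Field F] [NumberField F] (E : Type) [Field E] [NumberField E] [Algebra F E]
  [Algebra.IsQuadraticExtension F E] (c : E ≃ₐ[F] E) (N : ℕ) (J : Matrix (Fin N) (Fin N) E)
  (v : HeightOneSpectrum (𝓞 F))
  {δ₁ : E} (hcδ₁ : c δ₁ = -δ₁) (hδ₁ : δ₁ ≠ 0) {d₁ : F} (hd₁ : δ₁ * δ₁ = algebraMap F E d₁)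
  {δ₂ : E} (hcδ₂ : c δ₂ = -δ₂) (hδ₂ : δ₂ ≠ 0) {d₂ : F} (hd₂ : δ₂ * δ₂ = algebraMap F E d₂)
  {a : F} (ha : δ₂ = algebraMap F E a * δ₁)
  (T : Matrix (Fin N) (Fin N) F) (hT : T.IsSymm) (hJ : J = T.map (algebraMap F E))
  (r : Fin N → LocalRing E v)
  (D : ((Fin (N + N) → v.adicCompletion F) × (Fin (N + N) → v.adicCompletion F)) →ₗ[v.adicCompletion F]
    ((Fin (N + N) → v.adicCompletion F) × (Fin (N + N) → v.adicCompletion F)))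
  (hD : ∀ w, D w = (splitW (K := v.adicCompletion F) (e₂ N)).symm
    (localRootNil E c N J v hcδ₁ hδ₁ hd₁ r (splitW (e₂ N) w).1,
      (((a : v.adicCompletion F))⁻¹ • localRootNil E c N J v hcδ₂ hδ₂ hd₂ r) (splitW (e₂ N) w).2))

include hδ₂ ha in
omit [NumberField E] [Algebra.IsQuadraticExtension F E] in
/-- `a ≠ 0` in `F_v` (`δ₂ = a δ₁ ≠ 0`). [cite: Liu2021, App. D §D.1 Step 1 (l. 5217)] -/
theorem algebraMap_ratio_ne_zero : (a : v.adicCompletion F) ≠ 0 := by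
  refine (map_ne_zero (algebraMap F (v.adicCompletion F))).2 ?_
  rintro rfl
  exact hδ₂ (by rw [ha, map_zero, zero_mul])

include hD in
/-- **`(𝔫^⊕)² = 0`** (`r` isotropic). [cite: MoeglinVignerasWaldspurger1987, Chap. 1 I.17] -/
theorem doubledRootNil_comp_self (hr : hermForm (conjLocal E c v) ((adelicForm E N J).map (adeleToLocal E v)) r r = 0) :
    D ∘ₗ D = 0 :=
  blockEnd_comp_self_eq_zero (e₂ N) _ _ D hD (localRootNil_comp_self E c N J v hcδ₁ hδ₁ hd₁ hr)
    (by rw [LinearMap.smul_comp, LinearMap.comp_smul, localRootNil_comp_self E c N J v hcδ₂ hδ₂ hd₂ hr, smul_zero, smul_zero])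

include hT hJ hD in
/-- **`𝔫^⊕` is skew for `A^⊕ = A_T ⊕ A_{−T}`**. [cite: MoeglinVignerasWaldspurger1987, Chap. 1 I.17; Chap. 2 II.1 Rem. (6)] -/
theorem alt_polar_doubledRootNil_skew (hJh : (J.map c)ᵀ = J)
    (p q : (Fin (N + N) → v.adicCompletion F) × (Fin (N + N) → v.adicCompletion F)) :
    alt (polar (localPairing F (N + N) (gramD F N T) v)) (D p) q = - alt (polar (localPairing F (N + N) (gramD F N T) v)) p (D q) :=
  alt_polar_blockEnd_skew (e₂ N) (localGram F N T v) (-(localGram F N T v)) (localGram_gramD F v N T) _ _ D hD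
    (alt_polar_localRootNil_left E c N J v hcδ₁ hδ₁ hd₁ T hT hJ hJh r)
    (alt_polar_gram_neg_smul_skew (localGram F N T v) (alt_polar_localRootNil_left E c N J v hcδ₂ hδ₂ hd₂ T hT hJ hJh r) _) p q

include hδ₂ ha hT hJ hD in
/-- **duality of `im 𝔫^⊕(r)` and `im 𝔫^⊕(r')`** for a hyperbolic pair at a non-split place, block by block.
[cite: MoeglinVignerasWaldspurger1987, Chap. 1 I.17; Chap. 2 II.1 Rem. (6)] -/
theorem disjoint_range_doubledRootNil_orthogonal (hE : IsField (LocalRing E v)) {r' : Fin N → LocalRing E v}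
    (hrr' : hermForm (conjLocal E c v) ((adelicForm E N J).map (adeleToLocal E v)) r r' = 1)
    (hr'r : hermForm (conjLocal E c v) ((adelicForm E N J).map (adeleToLocal E v)) r' r = 1)
    (D' : ((Fin (N + N) → v.adicCompletion F) × (Fin (N + N) → v.adicCompletion F)) →ₗ[v.adicCompletion F]
      ((Fin (N + N) → v.adicCompletion F) × (Fin (N + N) → v.adicCompletion F)))
    (hD' : ∀ w, D' w = (splitW (K := v.adicCompletion F) (e₂ N)).symm
      (localRootNil E c N J v hcδ₁ hδ₁ hd₁ r' (splitW (e₂ N) w).1,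
        (((a : v.adicCompletion F))⁻¹ • localRootNil E c N J v hcδ₂ hδ₂ hd₂ r') (splitW (e₂ N) w).2)) :
    Disjoint (LinearMap.range D)
      (LinearMap.BilinForm.orthogonal (alt (polar (localPairing F (N + N) (gramD F N T) v))) (LinearMap.range D')) :=
  disjoint_range_blockEnd_orthogonal (e₂ N) (localGram F N T v) (-(localGram F N T v)) (localGram_gramD F v N T) _ _ D hD _ _ D' hD'
    (disjoint_range_localRootNil_orthogonal E c N J v hcδ₁ hδ₁ hd₁ T hT hJ hE hrr' hr'r)
    (disjoint_range_smul_orthogonal_gram_neg (localGram F N T v)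
      (disjoint_range_localRootNil_orthogonal E c N J v hcδ₂ hδ₂ hd₂ T hT hJ hE hrr' hr'r)
      (inv_ne_zero (algebraMap_ratio_ne_zero F E v hδ₂ ha)))

include hδ₂ ha hD in
/-- **`dim_{F_v} im 𝔫^⊕ = 4`** (`= 2 + 2`). [cite: MoeglinVignerasWaldspurger1987, Chap. 1 I.17; Chap. 2 II.1 Rem. (6)] -/
theorem finrank_range_doubledRootNil (hE : IsField (LocalRing E v)) {r' : Fin N → LocalRing E v}
    (hrr' : hermForm (conjLocal E c v) ((adelicForm E N J).map (adeleToLocal E v)) r r' = 1) :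
    Module.finrank (v.adicCompletion F) (LinearMap.range D) = 4 := by
  rw [finrank_range_blockEnd (e₂ N) _ _ D hD, finrank_range_localRootNil E c N J v hcδ₁ hδ₁ hd₁ hE hrr',
    LinearMap.range_smul _ _ (inv_ne_zero (algebraMap_ratio_ne_zero F E v hδ₂ ha)),
    finrank_range_localRootNil E c N J v hcδ₂ hδ₂ hd₂ hE hrr']

include ha hT hJ hD in
/-- **anisotropy of the doubled norm form**: at a non-split place and under the class hypothesis of
`rankOne_theta_lines_disjoint` (`ε₂ ∉ ε₁ · Nm E_vˣ`, `εᵢ = δᵢ ⊗ 1`), `A^⊕(w, 𝔫^⊕ w) = 0` forces `𝔫^⊕ w = 0`: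
`A^⊕(w, 𝔫^⊕ w) = Nm h(r, w₁) − a⁻¹ Nm h(r, w₂)` read in `E_v` is the form `ε₁ x xᶜ = ε₂ y yᶜ` of
`eps_doubledPlane_anisotropic`. [cite: Liu2021, App. D §D.1 Step 1 (l. 5217) and Lem. D.1 (3)]
[cite: MoeglinVignerasWaldspurger1987, Chap. 3 IV.4] -/
theorem doubledRootNil_eq_zero_of_alt_polar_self_eq_zero (hE : IsField (LocalRing E v))
    (hcls : ¬ ∃ x : (LocalRing E v)ˣ,
      Liu2021.LemD1OfPlace.eps E v hδ₂ = x * Units.map (conjLocal E c v : LocalRing E v →* LocalRing E v) x * Liu2021.LemD1OfPlace.eps E v hδ₁)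
    (hJh : (J.map c)ᵀ = J) (w : (Fin (N + N) → v.adicCompletion F) × (Fin (N + N) → v.adicCompletion F))
    (h0 : alt (polar (localPairing F (N + N) (gramD F N T) v)) w (D w) = 0) : D w = 0 := by
  have ha0 : (a : v.adicCompletion F) ≠ 0 := algebraMap_ratio_ne_zero F E v hδ₂ ha
  obtain ⟨u₁, hu₁⟩ : ∃ u₁, QuadraticCoordinates.reIm (quadraticLocalEquiv E v c hcδ₁ hδ₁).toLinearEquiv.toAddEquiv (Fin N) u₁ =
      (splitW (e₂ N) w).1 := ⟨_, AddEquiv.apply_symm_apply _ _⟩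
  obtain ⟨u₂, hu₂⟩ : ∃ u₂, QuadraticCoordinates.reIm (quadraticLocalEquiv E v c hcδ₂ hδ₂).toLinearEquiv.toAddEquiv (Fin N) u₂ =
      (splitW (e₂ N) w).2 := ⟨_, AddEquiv.apply_symm_apply _ _⟩
  set α₁ := hermForm (conjLocal E c v) ((adelicForm E N J).map (adeleToLocal E v)) r u₁ with hα₁
  set α₂ := hermForm (conjLocal E c v) ((adelicForm E N J).map (adeleToLocal E v)) r u₂ with hα₂
  -- read `h0` in the blocks and apply `φ = toLocalRing`
  have h0' := h0
  rw [alt_polar_blockEnd_right (e₂ N) (localGram F N T v) (-(localGram F N T v)) (localGram_gramD F v N T) _ _ D hD,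
    alt_polar_gram_neg, LinearMap.smul_apply, map_smul, smul_eq_mul, ← hu₁, ← hu₂] at h0'
  have h1 := toLocalRing_alt_polar_localRootNil_self E c N J v hcδ₁ hδ₁ hd₁ T hT hJ hJh r u₁
  have h2 := toLocalRing_alt_polar_localRootNil_self E c N J v hcδ₂ hδ₂ hd₂ T hT hJ hJh r u₂
  rw [← hα₁] at h1
  rw [← hα₂] at h2
  have hrel : toLocalRing E v (a : v.adicCompletion F) * (conjLocal E c v α₁ * α₁) = conjLocal E c v α₂ * α₂ := by
    rw [← h1, ← h2, ← map_mul]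
    congr 1
    have := add_eq_zero_iff_eq_neg.1 h0'
    rw [this, neg_neg, ← mul_assoc, mul_inv_cancel₀ ha0, one_mul]
  have hε₁ : (Liu2021.LemD1OfPlace.eps E v hδ₁ : LocalRing E v) = algebraMap E (LocalRing E v) δ₁ := rfl
  have hε₂ : (Liu2021.LemD1OfPlace.eps E v hδ₂ : LocalRing E v) =
      toLocalRing E v (a : v.adicCompletion F) * algebraMap E (LocalRing E v) δ₁ := by
    change algebraMap E (LocalRing E v) δ₂ = _
    rw [ha, map_mul, toLocalRing_coe]
  have hxy : (Liu2021.LemD1OfPlace.eps E v hδ₁ : LocalRing E v) * α₂ * conjLocal E c v α₂ =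
      (Liu2021.LemD1OfPlace.eps E v hδ₂ : LocalRing E v) * α₁ * conjLocal E c v α₁ := by
    rw [hε₁, hε₂]
    linear_combination (-(algebraMap E (LocalRing E v) δ₁)) * hrel
  obtain ⟨hα₂0, hα₁0⟩ := Liu2021.LemD1OfPlace.eps_doubledPlane_anisotropic E v c hδ₁ hδ₂ hE hcls hxy
  have hn₁ : localRootNil E c N J v hcδ₁ hδ₁ hd₁ r (splitW (e₂ N) w).1 = 0 := by
    rw [← hu₁]
    exact localRootNil_reIm_of_orth E c N J v hcδ₁ hδ₁ hd₁ (hα₁ ▸ hα₁0)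
  have hn₂ : localRootNil E c N J v hcδ₂ hδ₂ hd₂ r (splitW (e₂ N) w).2 = 0 := by
    rw [← hu₂]
    exact localRootNil_reIm_of_orth E c N J v hcδ₂ hδ₂ hd₂ (hα₂ ▸ hα₂0)
  rw [hD, hn₁, LinearMap.smul_apply, hn₂, smul_zero]
  exact map_zero (splitW (K := v.adicCompletion F) (e₂ N)).symm

omit [Algebra.IsQuadraticExtension F E] in
/-- **the underlying automorphism of `π(𝔻 u)`** is `(π(s₁ u) ⊕ 1)(1 ⊕ π(s₂ u))` — the second factor read in `Sp(𝕎⁻) = Sp(𝕎)`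
(`proj_diagonalDoubling`, `coe_spInl_mul_spInr`, `MpPsi.coe_proj_conjHom`). [cite: MoeglinVignerasWaldspurger1987, Chap. 2 II.1 Rem. (6)] -/
theorem coe_proj_diagonalDoubling (s₁ s₂ : UnitaryGroup.localPi E c N J v →* LocalMp F N T v) (u : UnitaryGroup.localPi E c N J v) :
    (((MpPsi.proj _ (diagonalDoubling F E c v N s₁ s₂ u)) : LocalSp F (N + N) (gramD F N T) v) :
      ((Fin (N + N) → v.adicCompletion F) × (Fin (N + N) → v.adicCompletion F)) ≃ₗ[v.adicCompletion F]
        ((Fin (N + N) → v.adicCompletion F) × (Fin (N + N) → v.adicCompletion F))) =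
      inlW (e₂ N) (MpPsi.proj (localSchrodinger F N T v) (s₁ u)).1 *
        inrW (e₂ N) (MpPsi.proj (localSchrodinger F N T v) (s₂ u)).1 :=
  -- kernel-friendly: the `𝕎⁻`-factor is moved back to `Sp(𝕎)` by `MpPsi.coe_proj_conjHom` through `congrArg`, never by defeq
  ((congrArg Subtype.val (proj_diagonalDoubling F E c v N s₁ s₂ u)).trans
    (coe_spInl_mul_spInr (e₂ N) (localGram F N T v) (localGram_gramD F v N T) _ _)).trans
    (congrArg (fun g => inlW (e₂ N) (MpPsi.proj (localSchrodinger F N T v) (s₁ u)).1 * inrW (e₂ N) g)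
      (MpPsi.coe_proj_conjHom (isLocallyConstant_of_isContinuousNontrivial (isContinuousNontrivial_adeleAddCharAt F v))
        (localGram F N T v) (continuous_toLinearMap₂'_left (localGram F N T v))
        (continuous_toLinearMap₂'_left (-(localGram F N T v))) (s₂ u)))

include ha hD in
/-- **`π(𝔻(n_{bδ₁}(r))) = 1 + b 𝔫^⊕`**: through the diagonal doubling of sections `s₁, s₂` over `ι_{δ₁}, ι_{δ₂}`, the root element
`n_{bδ₁}(r)` acts on `𝕎 ⊕ 𝕎⁻` by the unipotent `w ↦ w + b 𝔫^⊕ w` (`ι_{δ₁}(n_b) = 1 + b 𝔫_{δ₁}`, `ι_{δ₂}(n_b) = 1 + (b/a) 𝔫_{δ₂}`).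
[cite: MoeglinVignerasWaldspurger1987, Chap. 1 I.17; Chap. 2 II.1 Rem. (6)] -/
theorem proj_diagonalDoubling_localRootElt_apply (s₁ s₂ : UnitaryGroup.localPi E c N J v →* LocalMp F N T v)
    (hs₁ : ∀ g, MpPsi.proj _ (s₁ g) = iota F E c N hcδ₁ hδ₁ hd₁ T hT hJ v g)
    (hs₂ : ∀ g, MpPsi.proj _ (s₂ g) = iota F E c N hcδ₂ hδ₂ hd₂ T hT hJ v g) (hJh : (J.map c)ᵀ = J)
    (hr : hermForm (conjLocal E c v) ((adelicForm E N J).map (adeleToLocal E v)) r r = 0) (b : v.adicCompletion F)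
    (w : (Fin (N + N) → v.adicCompletion F) × (Fin (N + N) → v.adicCompletion F)) :
    ((MpPsi.proj _ (diagonalDoubling F E c v N s₁ s₂ (localRootElt E c N J v hcδ₁ hδ₁ hJh hr b)) :
        LocalSp F (N + N) (gramD F N T) v) :
      ((Fin (N + N) → v.adicCompletion F) × (Fin (N + N) → v.adicCompletion F)) ≃ₗ[v.adicCompletion F]
        ((Fin (N + N) → v.adicCompletion F) × (Fin (N + N) → v.adicCompletion F))) w = w + b • D w := by
  have hg₁ : ∀ p, (MpPsi.proj (localSchrodinger F N T v) (s₁ (localRootElt E c N J v hcδ₁ hδ₁ hJh hr b))).1 p =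
      p + b • localRootNil E c N J v hcδ₁ hδ₁ hd₁ r p := fun p => by
    rw [hs₁]
    exact iota_localRootElt_apply E c N J v hcδ₁ hδ₁ hd₁ T hT hJ hJh hr b p
  have hg₂ : ∀ p, (MpPsi.proj (localSchrodinger F N T v) (s₂ (localRootElt E c N J v hcδ₁ hδ₁ hJh hr b))).1 p =
      p + b • (((a : v.adicCompletion F))⁻¹ • localRootNil E c N J v hcδ₂ hδ₂ hd₂ r) p := fun p => by
    rw [hs₂, iota_localRootElt_apply_of_eq_mul E c N J v hcδ₁ hδ₁ hcδ₂ hδ₂ hd₂ ha T hT hJ hJh hr b p, LinearMap.smul_apply,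
      smul_smul, mul_comm]
  exact (LinearEquiv.congr_fun (coe_proj_diagonalDoubling F E c N J v T s₁ s₂ _) w).trans
    (inlW_mul_inrW_apply_of_blocks (e₂ N) _ _ D hD _ _ b hg₁ hg₂ w)

end Doubled

/-! ## §2 Packaged for `rankOne_theta_lines_disjoint` -/

section Packaged

variable (F : Type) [Field F] [NumberField F] (E : Type) [Field E] [NumberField E] [Algebra F E]
  [Algebra.IsQuadraticExtension F E] (c : E ≃ₐ[F] E) {N : ℕ} (hN : 3 ≤ N)
  {δ₁ : E} (hcδ₁ : c δ₁ = -δ₁) (hδ₁ : δ₁ ≠ 0) {d₁ : F} (hd₁ : δ₁ * δ₁ = algebraMap F E d₁)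
  {δ₂ : E} (hcδ₂ : c δ₂ = -δ₂) (hδ₂ : δ₂ ≠ 0) {d₂ : F} (hd₂ : δ₂ * δ₂ = algebraMap F E d₂)
  (T : Matrix (Fin N) (Fin N) F) (hT : T.IsSymm) (hTd : IsUnit T.det)
  {J : Matrix (Fin N) (Fin N) E} (hJ : J = T.map (algebraMap F E)) (v : HeightOneSpectrum (𝓞 F))

include hN hTd in
set_option maxHeartbeats 800000 in -- the twelve-clause packaging statement
/-- **The doubled root nilpotents of `rankOne_theta_lines_disjoint`.**  From the binders of the fact (`N ≥ 3`, `E_v` a field,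
the class hypothesis `ε₂ ∉ ε₁ · Nm`, sections `s₁, s₂` of the metaplectic cover over `ι_{δ₁}, ι_{δ₂}`): an isotropic `r ≠ 0`
with hyperbolic partner `r'` gives two one-parameter families `nr = n_{•δ₁}(r)`, `nr' = n_{•δ₁}(r')` in `U(V)(F_v)` whose
diagonal doublings act on `𝕎 ⊕ 𝕎⁻` as `1 + t 𝔫`, `1 + t 𝔫'` with `𝔫, 𝔫'` of square zero, skew for `A^⊕`, with images of
dimension `4` in duality, and with ANISOTROPIC norm forms `w ↦ A^⊕(w, 𝔫 w)`, `w ↦ A^⊕(w, 𝔫' w)` modulo their kernels — the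
input of the polarisation mover (P4) and the quadric engine (P7) of row IV-4(c1).
[cite: MoeglinVignerasWaldspurger1987, Chap. 3 IV.4; Chap. 1 I.17; Chap. 2 II.1 Rem. (6)] [cite: Liu2021, App. D Lem. D.1 (3)] -/
theorem exists_doubledRootNilpotents (hE : IsField (LocalRing E v))
    (hcls : ¬ ∃ x : (LocalRing E v)ˣ,
      Liu2021.LemD1OfPlace.eps E v hδ₂ = x * Units.map (conjLocal E c v : LocalRing E v →* LocalRing E v) x * Liu2021.LemD1OfPlace.eps E v hδ₁)
    (s₁ s₂ : UnitaryGroup.localPi E c N J v →* LocalMp F N T v)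
    (hs₁ : ∀ g, MpPsi.proj _ (s₁ g) = iota F E c N hcδ₁ hδ₁ hd₁ T hT hJ v g)
    (hs₂ : ∀ g, MpPsi.proj _ (s₂ g) = iota F E c N hcδ₂ hδ₂ hd₂ T hT hJ v g) :
    ∃ (nr nr' : v.adicCompletion F → UnitaryGroup.localPi E c N J v)
      (𝔫 𝔫' : ((Fin (N + N) → v.adicCompletion F) × (Fin (N + N) → v.adicCompletion F)) →ₗ[v.adicCompletion F]
        ((Fin (N + N) → v.adicCompletion F) × (Fin (N + N) → v.adicCompletion F))),
      (∀ t w, ((MpPsi.proj _ (diagonalDoubling F E c v N s₁ s₂ (nr t)) : LocalSp F (N + N) (gramD F N T) v) :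
          ((Fin (N + N) → v.adicCompletion F) × (Fin (N + N) → v.adicCompletion F)) ≃ₗ[v.adicCompletion F]
            ((Fin (N + N) → v.adicCompletion F) × (Fin (N + N) → v.adicCompletion F))) w = w + t • 𝔫 w) ∧
      (∀ t w, ((MpPsi.proj _ (diagonalDoubling F E c v N s₁ s₂ (nr' t)) : LocalSp F (N + N) (gramD F N T) v) :
          ((Fin (N + N) → v.adicCompletion F) × (Fin (N + N) → v.adicCompletion F)) ≃ₗ[v.adicCompletion F]
            ((Fin (N + N) → v.adicCompletion F) × (Fin (N + N) → v.adicCompletion F))) w = w + t • 𝔫' w) ∧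
      𝔫 ∘ₗ 𝔫 = 0 ∧ 𝔫' ∘ₗ 𝔫' = 0 ∧
      (∀ p q, alt (polar (localPairing F (N + N) (gramD F N T) v)) (𝔫 p) q =
        - alt (polar (localPairing F (N + N) (gramD F N T) v)) p (𝔫 q)) ∧
      (∀ p q, alt (polar (localPairing F (N + N) (gramD F N T) v)) (𝔫' p) q =
        - alt (polar (localPairing F (N + N) (gramD F N T) v)) p (𝔫' q)) ∧
      Disjoint (LinearMap.range 𝔫)
        (LinearMap.BilinForm.orthogonal (alt (polar (localPairing F (N + N) (gramD F N T) v))) (LinearMap.range 𝔫')) ∧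
      Disjoint (LinearMap.range 𝔫')
        (LinearMap.BilinForm.orthogonal (alt (polar (localPairing F (N + N) (gramD F N T) v))) (LinearMap.range 𝔫)) ∧
      Module.finrank (v.adicCompletion F) (LinearMap.range 𝔫) = 4 ∧
      Module.finrank (v.adicCompletion F) (LinearMap.range 𝔫') = 4 ∧
      (∀ w, alt (polar (localPairing F (N + N) (gramD F N T) v)) w (𝔫 w) = 0 → 𝔫 w = 0) ∧
      (∀ w, alt (polar (localPairing F (N + N) (gramD F N T) v)) w (𝔫' w) = 0 → 𝔫' w = 0) := by
  have hJh : (J.map c)ᵀ = J := by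
    rw [hJ, Matrix.map_map]
    have h : (⇑c ∘ ⇑(algebraMap F E)) = ⇑(algebraMap F E) := funext fun t => c.commutes t
    rw [h, ← Matrix.transpose_map, hT.eq]
  have hJdet : J.det ≠ 0 := by
    rw [hJ]
    exact (isUnit_det_map (algebraMap F E) hTd).ne_zero
  obtain ⟨a, ha⟩ := exists_eq_algebraMap_mul_of_apply_eq_neg E c hcδ₁ hδ₁ hcδ₂
  obtain ⟨r, hr0, hr⟩ := exists_isotropic_localGram E c N J v hcδ₁ hδ₁ hN hJh hJdet
  obtain ⟨r', hr', hrr'⟩ := exists_hyperbolic_partner_localGram E c N J v hcδ₁ hδ₁ hE hJh hJdet hr hr0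
  have hr'r := hermForm_localGram_partner_symm E c N J v hcδ₁ hδ₁ hJh hrr'
  -- the two doubled nilpotents (opaque `D`, `D'` with their block descriptions)
  have hDex : ∀ x : Fin N → LocalRing E v,
      ∃ D : ((Fin (N + N) → v.adicCompletion F) × (Fin (N + N) → v.adicCompletion F)) →ₗ[v.adicCompletion F]
        ((Fin (N + N) → v.adicCompletion F) × (Fin (N + N) → v.adicCompletion F)),
        ∀ w, D w = (splitW (K := v.adicCompletion F) (e₂ N)).symm
          (localRootNil E c N J v hcδ₁ hδ₁ hd₁ x (splitW (e₂ N) w).1,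
            (((a : v.adicCompletion F))⁻¹ • localRootNil E c N J v hcδ₂ hδ₂ hd₂ x) (splitW (e₂ N) w).2) := fun x =>
    ⟨(splitW (K := v.adicCompletion F) (e₂ N)).symm.toLinearMap ∘ₗ
      ((localRootNil E c N J v hcδ₁ hδ₁ hd₁ x).prodMap (((a : v.adicCompletion F))⁻¹ • localRootNil E c N J v hcδ₂ hδ₂ hd₂ x)) ∘ₗ
        (splitW (K := v.adicCompletion F) (e₂ N)).toLinearMap, fun w => by
      simp only [LinearMap.comp_apply, LinearEquiv.coe_toLinearMap, LinearMap.prodMap_apply]⟩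
  obtain ⟨D, hD⟩ := hDex r
  obtain ⟨D', hD'⟩ := hDex r'
  refine ⟨fun t => localRootElt E c N J v hcδ₁ hδ₁ hJh hr t, fun t => localRootElt E c N J v hcδ₁ hδ₁ hJh hr' t, D, D',
    fun t w => ?_, fun t w => ?_, ?_, ?_, ?_, ?_, ?_, ?_, ?_, ?_, fun w => ?_, fun w => ?_⟩
  · exact proj_diagonalDoubling_localRootElt_apply F E c N J v hcδ₁ hδ₁ hd₁ hcδ₂ hδ₂ hd₂ ha T hT hJ r D hD s₁ s₂ hs₁ hs₂ hJh hr t w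
  · exact proj_diagonalDoubling_localRootElt_apply F E c N J v hcδ₁ hδ₁ hd₁ hcδ₂ hδ₂ hd₂ ha T hT hJ r' D' hD' s₁ s₂ hs₁ hs₂ hJh hr' t w
  · exact doubledRootNil_comp_self F E c N J v hcδ₁ hδ₁ hd₁ hcδ₂ hδ₂ hd₂ r D hD hr
  · exact doubledRootNil_comp_self F E c N J v hcδ₁ hδ₁ hd₁ hcδ₂ hδ₂ hd₂ r' D' hD' hr'
  · exact alt_polar_doubledRootNil_skew F E c N J v hcδ₁ hδ₁ hd₁ hcδ₂ hδ₂ hd₂ T hT hJ r D hD hJh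
  · exact alt_polar_doubledRootNil_skew F E c N J v hcδ₁ hδ₁ hd₁ hcδ₂ hδ₂ hd₂ T hT hJ r' D' hD' hJh
  · exact disjoint_range_doubledRootNil_orthogonal F E c N J v hcδ₁ hδ₁ hd₁ hcδ₂ hδ₂ hd₂ ha T hT hJ r D hD hE hrr' hr'r D' hD'
  · exact disjoint_range_doubledRootNil_orthogonal F E c N J v hcδ₁ hδ₁ hd₁ hcδ₂ hδ₂ hd₂ ha T hT hJ r' D' hD' hE hr'r hrr' D hD
  · exact finrank_range_doubledRootNil F E c N J v hcδ₁ hδ₁ hd₁ hcδ₂ hδ₂ hd₂ ha r D hD hE hrr'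
  · exact finrank_range_doubledRootNil F E c N J v hcδ₁ hδ₁ hd₁ hcδ₂ hδ₂ hd₂ ha r' D' hD' hE hr'r
  · exact doubledRootNil_eq_zero_of_alt_polar_self_eq_zero F E c N J v hcδ₁ hδ₁ hd₁ hcδ₂ hδ₂ hd₂ ha T hT hJ r D hD hE hcls hJh w
  · exact doubledRootNil_eq_zero_of_alt_polar_self_eq_zero F E c N J v hcδ₁ hδ₁ hd₁ hcδ₂ hδ₂ hd₂ ha T hT hJ r' D' hD' hE hcls hJh w

end Packaged

end Literature.RepresentationTheory.MoeglinVignerasWaldspurger1987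

end
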